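import Summits.KontsevichZagierPeriods.KontsevichZagierPeriods.Theorems.HodgeColevelSameDegreeStrength
import Summits.KontsevichZagierPeriods.KontsevichZagierPeriods.Theorems.ComplexOrientationsOrientationKernelDimensionOneMerge
import Literature.NumberTheory.Transcendental.KZDirichletCharts

/-!
# `SameDegreeConjecture` (stmt-KontsevichZagierPeriods-6178) — strength of its dimension-wise split

Support file for the crux-strategist census of the HodgeColevel crux `SameDegreeConjecture`
(`≡ KontsevichZagierPeriods`, `SameDegreeStrength.sameDegreeConjecture_iff_kontsevichZagierPeriods`).
Its only typed decomposition with a proved assembly is the split by the dimension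
(`SameDegreeStrength.kontsevichZagierPeriods_of_sameDegreeOne_of_twoUp`; the registered skeleton
`Cruxes/SameDegreeConjecture/Lines/birth.lean` cuts the same way):
`SameDegreeConjecture ⟸ SameDegreeOne ∧ SDC_{≥ 2}` (`SDC_{≥ 2}` := same degree in every `d ≥ 2`).

Write `Flat` for the (absurd, but unrefuted in print and in the tree) statement that EVERY KZ
integral representation is move-equivalent to a `1`-dimensional one — the collapse of the degree
filtration of the calculus to level one (at the level of values its negation is J. Wan's Problem 1:
exhibit a period of degree `≥ 3`). This file proves, unconditionally,

  **`SDC_{≥ 2} ↔ (Flat ∨ KontsevichZagierPeriods)`**  (`sameDegreeTwoUp_iff_flat_or_kontsevichZagierPeriods`)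

and `Flat → (SameDegreeOne ↔ KontsevichZagierPeriods)` (`sameDegreeOne_iff_kontsevichZagierPeriods_of_flat`):
the top piece is the summit in every world in which some period has degree `≥ 3` — e.g. given ANY
of the route's degree items, each of which refutes `Flat` (`not_flat_of_incompressible`,
`not_flat_of_piSquaredDegree`) — and in the `Flat` world the bottom piece is the summit. The engine
is `of_mem_relations_dimOne_of_sameDegreeAt`, the **collapse at the least non-flat dimension `D`**
(three moves, no normal form, no transcendence input): split a non-compressing `D`-dimensional `q`
along `x_D = 2` (rule (1a)) — one half `p` still does not compress to dimension `1`, else the halves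
MERGE in dimension one (`ComplexOrientations.OrientationKernel.exists_add_sub_mem_relations_one`);
lift a value-`0` representation `s` of dimension `1` into the band `x_D ∈ [j, j+1]` missed by `p`
(rule (3)) and glue (rule (1a)); the glued `A` has the value of `p` and is incompressible (`A ∼ t`,
`dim t < D` ⇒ `t ∼ t₁`, `dim t₁ = 1`, by minimality ⇒ `[p] ≡ [t₁] + [s.neg] ≡ [c]` by the merge);
same degree at `D` gives `A ∼ p`, so the lift of `s`, hence `s`, is a relation.
§§4–5: the instance through the support item `PiSquaredDegree`, and the birth skeleton's cube stubs.

References: M. Kontsevich, D. Zagier, *Periods* (2001), §1.2, rules (1)–(3), Conjecture 1,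
Problem 2 [cite: KontsevichZagierPeriods2001, §1.2]; J. Wan, *Degrees of periods*, arXiv:1102.2273
(2011), Def. 3.1, Prop. 3.2, Problem 1; J. Viu-Sos, *Periods of Kontsevich–Zagier I: a semi-canonical
reduction*, arXiv:1509.01097, §1 (non-uniqueness of the dimension; degree of a period).
-/

noncomputable section

open MeasureTheory Set
open Literature.NumberTheory.Transcendental
open Summit.KontsevichZagierPeriods.KontsevichZagierPeriods.Theses.HodgeColevel
open Summit.KontsevichZagierPeriods.ComplexOrientations.OrientationKernel
  (exists_add_sub_mem_relations_one)

namespace Summit.KontsevichZagierPeriods.HodgeColevel.SameDegreeTwoUpStrength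

/-! ## §1 Bookkeeping: compression to dimension one, incompressibility, lifts into a band -/

/-- If every representation of dimension `< D` compresses to dimension `1`, a representation not
equivalent to any `1`-dimensional one is not equivalent to anything of dimension `< D`.
[Kontsevich–Zagier 2001, §1.2] [folklore] -/
theorem incompressible_of_not_equivalent_one {D : ℕ}
    (hlow : ∀ k < D, ∀ t : KZ.IntegralRep k, ∃ t₁ : KZ.IntegralRep 1, KZ.Equivalent t t₁)
    {d : ℕ} (p : KZ.IntegralRep d) (hp : ∀ t₁ : KZ.IntegralRep 1, ¬ KZ.Equivalent p t₁) :
    ∀ k < D, ∀ t : KZ.IntegralRep k, ¬ KZ.Equivalent p t := fun k hk t hpt => by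
  obtain ⟨t₁, ht₁⟩ := hlow k hk t
  exact hp t₁ (hpt.trans ht₁)

/-- Lift of a `1`-dimensional representation to dimension `n + 2` inside the band
`x_{n+2} ∈ [j, j+1]` (iterated slabs, rule (3)). [Kontsevich–Zagier 2001, §1.2] [folklore] -/
theorem exists_lift_band (s : KZ.IntegralRep 1) (n j : ℕ) :
    ∃ L : KZ.IntegralRep (n + 2), KZ.Equivalent s L ∧
      ∀ z ∈ L.domain, (j : ℝ) ≤ z (Fin.last (n + 1)) ∧ z (Fin.last (n + 1)) ≤ j + 1 := by
  obtain ⟨M, hM⟩ := s.exists_equivalent_of_le (show 1 ≤ n + 1 by omega)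
  exact ⟨M.slab j, hM.trans (M.equivalent_slab j), fun z hz => ⟨hz.2.1, hz.2.2⟩⟩

/-! ## §2 Collapse at the least non-flat dimension -/

/-- **Collapse, banded form** at `D = n + 2`: same degree at `D`, compression of everything below
`D` to dimension `1`, and ONE `D`-dimensional `p` not compressing to dimension `1` and supported off
the band `x_D ∈ [j, j+1]` force zero form in dimension `1` (glue the lift of `s` into the band to
`p`; the glued representation has the value of `p` and is incompressible by the merge in dimension
one; same degree at `D` then makes the lift of `s`, hence `s`, a relation).
[Kontsevich–Zagier 2001, §1.2 Conjecture 1, rules (1)–(3)] [folklore] -/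
theorem of_mem_relations_dimOne_of_sameDegreeAt_of_band {n : ℕ}
    (hS : ∀ r r' : KZ.IntegralRep (n + 2),
      (∀ k < n + 2, ∀ t : KZ.IntegralRep k, ¬ KZ.Equivalent r t) →
      (∀ k < n + 2, ∀ t : KZ.IntegralRep k, ¬ KZ.Equivalent r' t) → r.value = r'.value →
      KZ.Equivalent r r')
    (hlow : ∀ k < n + 2, ∀ t : KZ.IntegralRep k, ∃ t₁ : KZ.IntegralRep 1, KZ.Equivalent t t₁)
    (p : KZ.IntegralRep (n + 2)) (hp : ∀ t : KZ.IntegralRep 1, ¬ KZ.Equivalent p t)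
    (j : ℕ) (hband : ∀ z ∈ p.domain, z (Fin.last (n + 1)) < j ∨ (j : ℝ) + 1 < z (Fin.last (n + 1)))
    (s : KZ.IntegralRep 1) (hs0 : s.value = 0) : KZ.of s ∈ KZ.relations := by
  -- rule (3): lift `s` into the band; the lift misses `p`
  obtain ⟨L, hsL, hLband⟩ := exists_lift_band s n j
  have hsL' : KZ.of s - KZ.of L ∈ KZ.relations := hsL
  have hdisj : Disjoint p.domain L.domain := Set.disjoint_left.2 fun z hzp hzL => by
    obtain ⟨h₁, h₂⟩ := hLband z hzL
    rcases hband z hzp with h | h <;> linarith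
  -- rule (1a): glue
  obtain ⟨A, hglue⟩ : ∃ A : KZ.IntegralRep (n + 2),
      KZ.of A - KZ.of p - KZ.of L ∈ KZ.relations :=
    ⟨p.glue L hdisj, KZ.domainAddRel_subset_relations
      (KZ.IntegralRep.of_glue_sub_sub_mem_domainAddRel p L hdisj)⟩
  -- values (soundness of the moves)
  have hL0 : L.value = 0 := (KZ.Equivalent.value_eq_holds hsL).symm.trans hs0
  have hAval : A.value = p.value := by
    have h := KZ.relations_le_ker_eval_holds hglue
    rwa [AddMonoidHom.mem_ker, map_sub, map_sub, KZ.eval_of, KZ.eval_of, KZ.eval_of, hL0,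
      sub_zero, sub_eq_zero] at h
  -- incompressibility of `p` and of the glued representation
  have hpinc := incompressible_of_not_equivalent_one hlow p hp
  have hAinc : ∀ k < n + 2, ∀ t : KZ.IntegralRep k, ¬ KZ.Equivalent A t := by
    refine incompressible_of_not_equivalent_one hlow A fun t₁ ht₁ => ?_
    -- merge `t₁` and `s.neg` INSIDE dimension one: `[t₁] + [s.neg] ≡ [c]`
    obtain ⟨c, hc⟩ := exists_add_sub_mem_relations_one t₁ s.neg
    refine hp c ?_
    have e : KZ.of p - KZ.of c = (KZ.of A - KZ.of t₁) - (KZ.of A - KZ.of p - KZ.of L) +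
        (KZ.of s - KZ.of L) + (KZ.of t₁ + KZ.of s.neg - KZ.of c) - (KZ.of s + KZ.of s.neg) := by
      abel
    show KZ.of p - KZ.of c ∈ KZ.relations
    rw [e]
    exact KZ.relations.sub_mem (KZ.relations.add_mem (KZ.relations.add_mem
      (KZ.relations.sub_mem ht₁ hglue) hsL') hc) (SameDegreeStrength.of_add_of_neg_mem_relations s)
  -- same degree at `D`: the glued representation is `p`, so the lift of `s` is a relation
  have hAp : KZ.of A - KZ.of p ∈ KZ.relations := hS A p hAinc hpinc hAval
  have hL : KZ.of L ∈ KZ.relations := by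
    have e : KZ.of L = (KZ.of A - KZ.of p) - (KZ.of A - KZ.of p - KZ.of L) := by abel
    rw [e]
    exact KZ.relations.sub_mem hAp hglue
  have e : KZ.of s = (KZ.of s - KZ.of L) + KZ.of L := by abel
  rw [e]
  exact KZ.relations.add_mem hsL' hL

open MvPolynomial in
/-- **Collapse at the least non-flat dimension**, band hypothesis removed: split `q` along
`x_D = 2` (rule (1a)); both halves compressing to dimension `1` would merge there and compress `q`;
the half that does not misses the band `[2, 3]` (lower) or `[0, 1]` (upper).
[Kontsevich–Zagier 2001, §1.2 Conjecture 1, rules (1)–(3)] [folklore] -/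
theorem of_mem_relations_dimOne_of_sameDegreeAt {n : ℕ}
    (hS : ∀ r r' : KZ.IntegralRep (n + 2),
      (∀ k < n + 2, ∀ t : KZ.IntegralRep k, ¬ KZ.Equivalent r t) →
      (∀ k < n + 2, ∀ t : KZ.IntegralRep k, ¬ KZ.Equivalent r' t) → r.value = r'.value →
      KZ.Equivalent r r')
    (hlow : ∀ k < n + 2, ∀ t : KZ.IntegralRep k, ∃ t₁ : KZ.IntegralRep 1, KZ.Equivalent t t₁)
    (q : KZ.IntegralRep (n + 2)) (hq : ∀ t : KZ.IntegralRep 1, ¬ KZ.Equivalent q t)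
    (s : KZ.IntegralRep 1) (hs0 : s.value = 0) : KZ.of s ∈ KZ.relations := by
  classical
  -- rule (1a): split `q` along the hyperplane `x_D = 2`
  have hH : Literature.ModelTheory.ExponentialFields.IsSemialgebraic ℚ
      {z : Fin (n + 2) → ℝ | z (Fin.last (n + 1)) < 2} := by
    simpa using Literature.ModelTheory.ExponentialFields.isSemialgebraic_setOf_eval_lt (k := ℚ)
      (R := ℝ) (X (Fin.last (n + 1)) : MvPolynomial (Fin (n + 2)) ℚ) 2
  have hE₁ := q.isSemialgebraic_domain.inter hH
  have hE₂ := q.isSemialgebraic_domain.diff hH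
  set q₁ : KZ.IntegralRep (n + 2) := q.restrict _ hE₁ Set.inter_subset_left with hq₁
  set q₂ : KZ.IntegralRep (n + 2) := q.restrict _ hE₂ Set.sdiff_subset with hq₂
  have hd : Disjoint q₁.domain q₂.domain :=
    Set.disjoint_sdiff_right.mono_left Set.inter_subset_right
  have hsplit : KZ.of q - KZ.of q₁ - KZ.of q₂ ∈ KZ.relations :=
    KZ.domainAddRel_subset_relations ⟨n + 2, q, q₁, q₂, (Set.inter_union_sdiff _ _).symm,
      by rw [hd.inter_eq]; exact measure_empty, fun _ _ => rfl, fun _ _ => rfl, rfl⟩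
  -- one half does not compress to dimension one (else merge the halves in dimension one)
  have key : (∀ t : KZ.IntegralRep 1, ¬ KZ.Equivalent q₁ t) ∨
      (∀ t : KZ.IntegralRep 1, ¬ KZ.Equivalent q₂ t) := by
    by_contra h
    push Not at h
    obtain ⟨⟨a, ha⟩, ⟨b, hb⟩⟩ := h
    obtain ⟨c, hc⟩ := exists_add_sub_mem_relations_one a b
    refine hq c ?_
    have e : KZ.of q - KZ.of c = (KZ.of q - KZ.of q₁ - KZ.of q₂) + (KZ.of q₁ - KZ.of a) +
        (KZ.of q₂ - KZ.of b) + (KZ.of a + KZ.of b - KZ.of c) := by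
      abel
    show KZ.of q - KZ.of c ∈ KZ.relations
    rw [e]
    exact KZ.relations.add_mem (KZ.relations.add_mem (KZ.relations.add_mem hsplit ha) hb) hc
  rcases key with h₁ | h₂
  · -- the lower half misses the band `[2, 3]`
    refine of_mem_relations_dimOne_of_sameDegreeAt_of_band hS hlow q₁ h₁ 2 (fun z hz => ?_) s hs0
    have hz' : z ∈ q.domain ∩ {z : Fin (n + 2) → ℝ | z (Fin.last (n + 1)) < 2} := hz
    have hlt : z (Fin.last (n + 1)) < 2 := hz'.2
    left
    exact_mod_cast hlt
  · -- the upper half misses the band `[0, 1]`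
    refine of_mem_relations_dimOne_of_sameDegreeAt_of_band hS hlow q₂ h₂ 0 (fun z hz => ?_) s hs0
    have hz' : z ∈ q.domain \ {z : Fin (n + 2) → ℝ | z (Fin.last (n + 1)) < 2} := hz
    have hle : ¬ z (Fin.last (n + 1)) < 2 := hz'.2
    right
    push_cast
    linarith [not_lt.mp hle]

/-! ## §3 `SDC_{≥ 2} ↔ (Flat ∨ KontsevichZagierPeriods)` -/

/-- Zero form in dimension `1` and same degree in every dimension `≥ 2` give the summit (dimension
`0` is free, dimensions `≥ 2` by the sign trick, zero form is the summit — all `SameDegreeStrength` /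
`DegreeCompressionStrength`). [Kontsevich–Zagier 2001, §1.2 Conjecture 1] [folklore] -/
theorem kontsevichZagierPeriods_of_zeroFormOne_of_sameDegreeTwoUp
    (hZ1 : ∀ s : KZ.IntegralRep 1, s.value = 0 → KZ.of s ∈ KZ.relations)
    (h2 : ∀ d : ℕ, 2 ≤ d → ∀ r r' : KZ.IntegralRep d,
      (∀ k < d, ∀ t : KZ.IntegralRep k, ¬ KZ.Equivalent r t) →
      (∀ k < d, ∀ t : KZ.IntegralRep k, ¬ KZ.Equivalent r' t) → r.value = r'.value →
      KZ.Equivalent r r') :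
    KontsevichZagierPeriods := by
  refine SameDegreeStrength.kontsevichZagierPeriods_of_zeroForm
    (SameDegreeStrength.zeroForm_of_incompressible fun d s hinc hs0 => ?_)
  rcases Nat.lt_or_ge d 2 with hd | hd
  · interval_cases d
    · exact DegreeCompressionStrength.of_mem_relations_of_dimZero s hs0
    · exact hZ1 s hs0
  · exact SameDegreeStrength.of_mem_relations_of_incompressible (h2 d hd) s hinc hs0

/-- The collapse at a dimension `D ≥ 2` (reindexing `D = n + 2`).
[Kontsevich–Zagier 2001, §1.2 Conjecture 1] [folklore] -/
theorem of_mem_relations_dimOne_of_minimal {D : ℕ} (hD : 2 ≤ D)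
    (hS : ∀ r r' : KZ.IntegralRep D,
      (∀ k < D, ∀ t : KZ.IntegralRep k, ¬ KZ.Equivalent r t) →
      (∀ k < D, ∀ t : KZ.IntegralRep k, ¬ KZ.Equivalent r' t) → r.value = r'.value →
      KZ.Equivalent r r')
    (hlow : ∀ k < D, ∀ t : KZ.IntegralRep k, ∃ t₁ : KZ.IntegralRep 1, KZ.Equivalent t t₁)
    (q : KZ.IntegralRep D) (hq : ∀ t : KZ.IntegralRep 1, ¬ KZ.Equivalent q t)
    (s : KZ.IntegralRep 1) (hs0 : s.value = 0) : KZ.of s ∈ KZ.relations := by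
  obtain ⟨n, rfl⟩ : ∃ n, D = n + 2 := ⟨D - 2, by omega⟩
  exact of_mem_relations_dimOne_of_sameDegreeAt hS hlow q hq s hs0

/-- **`¬Flat → SDC_{≥ 2} → KontsevichZagierPeriods`**: take the least dimension `D` carrying a
representation that does not compress to dimension `1` (`D ≥ 2`); below `D` everything compresses,
so the collapse at `D` gives zero form in dimension `1`. No normal form, no transcendence input, no
representation of any specific period. [Kontsevich–Zagier 2001, §1.2 Conjecture 1] [folklore] -/
theorem kontsevichZagierPeriods_of_sameDegreeTwoUp_of_not_flat
    (h2 : ∀ d : ℕ, 2 ≤ d → ∀ r r' : KZ.IntegralRep d,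
      (∀ k < d, ∀ t : KZ.IntegralRep k, ¬ KZ.Equivalent r t) →
      (∀ k < d, ∀ t : KZ.IntegralRep k, ¬ KZ.Equivalent r' t) → r.value = r'.value →
      KZ.Equivalent r r')
    (hnf : ¬ ∀ (d : ℕ) (r : KZ.IntegralRep d), ∃ t : KZ.IntegralRep 1, KZ.Equivalent r t) :
    KontsevichZagierPeriods := by
  classical
  have hex : ∃ d : ℕ, ∃ r : KZ.IntegralRep d, ∀ t : KZ.IntegralRep 1, ¬ KZ.Equivalent r t := by
    by_contra h
    push Not at h
    exact hnf h
  -- the least non-flat dimension, a witness `q`, and compression below it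
  obtain ⟨q, hq⟩ := Nat.find_spec hex
  have hlow : ∀ k < Nat.find hex, ∀ t : KZ.IntegralRep k,
      ∃ t₁ : KZ.IntegralRep 1, KZ.Equivalent t t₁ := fun k hk t => by
    by_contra h
    push Not at h
    exact Nat.find_min hex hk ⟨t, h⟩
  have hD : 2 ≤ Nat.find hex := by
    by_contra hlt
    push Not at hlt
    obtain ⟨t, ht⟩ := q.exists_equivalent_of_le (show Nat.find hex ≤ 1 by omega)
    exact hq t ht
  exact kontsevichZagierPeriods_of_zeroFormOne_of_sameDegreeTwoUp
    (fun s hs0 => of_mem_relations_dimOne_of_minimal hD (h2 _ hD) hlow q hq s hs0) h2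

/-- `Flat → SDC_{≥ 2}`, vacuously: in the flat world no representation of dimension `≥ 2` is
incompressible. [Kontsevich–Zagier 2001, §1.2] [folklore] -/
theorem sameDegreeTwoUp_of_flat
    (hf : ∀ (d : ℕ) (r : KZ.IntegralRep d), ∃ t : KZ.IntegralRep 1, KZ.Equivalent r t) :
    ∀ d : ℕ, 2 ≤ d → ∀ r r' : KZ.IntegralRep d,
      (∀ k < d, ∀ t : KZ.IntegralRep k, ¬ KZ.Equivalent r t) →
      (∀ k < d, ∀ t : KZ.IntegralRep k, ¬ KZ.Equivalent r' t) → r.value = r'.value →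
      KZ.Equivalent r r' := fun d hd r _ hr _ _ => by
  obtain ⟨t, ht⟩ := hf d r
  exact absurd ht (hr 1 (by omega) t)

/-- **`SDC_{≥ 2} ↔ (Flat ∨ KontsevichZagierPeriods)`** — the top piece of the dimension-wise split
of `SameDegreeConjecture` is EXACTLY "the summit, or the degree filtration of the calculus collapses
to level one" (converse directions: `sameDegreeTwoUp_of_flat` and the proved sibling
`coresOfSummit_proof`). [Kontsevich–Zagier 2001, §1.2 Conjecture 1] [folklore] -/
theorem sameDegreeTwoUp_iff_flat_or_kontsevichZagierPeriods :
    (∀ d : ℕ, 2 ≤ d → ∀ r r' : KZ.IntegralRep d,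
      (∀ k < d, ∀ t : KZ.IntegralRep k, ¬ KZ.Equivalent r t) →
      (∀ k < d, ∀ t : KZ.IntegralRep k, ¬ KZ.Equivalent r' t) → r.value = r'.value →
      KZ.Equivalent r r') ↔
    ((∀ (d : ℕ) (r : KZ.IntegralRep d), ∃ t : KZ.IntegralRep 1, KZ.Equivalent r t) ∨
      KontsevichZagierPeriods) :=
  ⟨fun h2 => or_iff_not_imp_left.2 (kontsevichZagierPeriods_of_sameDegreeTwoUp_of_not_flat h2),
    fun h => h.elim sameDegreeTwoUp_of_flat fun hS d _ => (coresOfSummit_proof hS).2 d⟩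

/-- **Any incompressible representation of dimension `≥ 2` refutes `Flat`** (so each of the route's
degree items, once its representation is exhibited, puts us in the world where `SDC_{≥ 2}` is the
summit). [Kontsevich–Zagier 2001, §1.2] [folklore] -/
theorem not_flat_of_incompressible {d : ℕ} (hd : 2 ≤ d) (q : KZ.IntegralRep d)
    (hinc : ∀ k < d, ∀ t : KZ.IntegralRep k, ¬ KZ.Equivalent q t) :
    ¬ ∀ (d : ℕ) (r : KZ.IntegralRep d), ∃ t : KZ.IntegralRep 1, KZ.Equivalent r t := fun hf => by
  obtain ⟨t, ht⟩ := hf d q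
  exact hinc 1 (by omega) t ht

/-- **In the `Flat` world the summit lives in dimension one: `SameDegreeOne ↔ S`** (a value-`0`
representation is equivalent to a `1`-dimensional one of value `0`, null by
`SameDegreeStrength.of_mem_relations_of_dim_one`; converse by `coresOfSummit_proof` at `d = 1`) — so
in NEITHER world is a piece of the split strictly easier than the crux.
[Kontsevich–Zagier 2001, §1.2 Conjecture 1] [folklore] -/
theorem sameDegreeOne_iff_kontsevichZagierPeriods_of_flat
    (hf : ∀ (d : ℕ) (r : KZ.IntegralRep d), ∃ t : KZ.IntegralRep 1, KZ.Equivalent r t) :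
    SameDegreeOne ↔ KontsevichZagierPeriods := by
  refine ⟨fun h1 => SameDegreeStrength.kontsevichZagierPeriods_of_zeroForm fun d s hs0 => ?_,
    fun hS r r' hr hr' hv => (coresOfSummit_proof hS).2 1 r r'
      (fun k hk t => by obtain rfl : k = 0 := Nat.lt_one_iff.mp hk; exact hr t)
      (fun k hk t => by obtain rfl : k = 0 := Nat.lt_one_iff.mp hk; exact hr' t) hv⟩
  obtain ⟨t, ht⟩ := hf d s
  have ht0 : t.value = 0 := (KZ.Equivalent.value_eq_holds ht).symm.trans hs0
  have e : KZ.of s = (KZ.of s - KZ.of t) + KZ.of t := by abel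
  rw [e]
  exact KZ.relations.add_mem ht (SameDegreeStrength.of_mem_relations_of_dim_one h1 t ht0)

/-! ## §4 The square representation of `π²`: `PiSquaredDegree → ¬Flat`, `PiSquaredDegree → SDC_{≥ 2} → S` -/

open MvPolynomial in
/-- The representation `[(0,1)², 16/((1+x²)(1+y²))]` of `π²` named by the support item `PiSquaredDegree`
exists (`KZ.isSemialgebraic_box2`, `isSemialgebraicFunOn_aeval_div_aeval`, a continuous integrand on
a relatively compact box). [Kontsevich–Zagier 2001, §1.1] [folklore] -/
theorem exists_piSquaredRep :
    ∃ q : KZ.IntegralRep 2, q.domain = {z | z 0 ∈ Set.Ioo (0:ℝ) 1 ∧ z 1 ∈ Set.Ioo (0:ℝ) 1} ∧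
      Set.EqOn q.integrand (fun z => 16 / ((1 + z 0 ^ 2) * (1 + z 1 ^ 2))) q.domain := by
  have hsa : IsSemialgebraicFunOn ℚ {z : Fin 2 → ℝ | z 0 ∈ Set.Ioo (0:ℝ) 1 ∧ z 1 ∈ Set.Ioo (0:ℝ) 1}
      (fun z => 16 / ((1 + z 0 ^ 2) * (1 + z 1 ^ 2))) := by
    refine (isSemialgebraicFunOn_aeval_div_aeval KZ.isSemialgebraic_box2
      (C 16 : MvPolynomial (Fin 2) ℚ) ((1 + X 0 ^ 2) * (1 + X 1 ^ 2)) fun z _ => ?_).congr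
      fun z _ => ?_
    · simp only [map_mul, map_add, map_one, map_pow, aeval_X]
      positivity
    · simp only [map_mul, map_add, map_one, map_pow, aeval_X, aeval_C, eq_ratCast, Rat.cast_ofNat]
  have hcont : Continuous fun z : Fin 2 → ℝ => 16 / ((1 + z 0 ^ 2) * (1 + z 1 ^ 2)) :=
    continuous_const.div (by fun_prop) fun z => by positivity
  have hsub : {z : Fin 2 → ℝ | z 0 ∈ Set.Ioo (0:ℝ) 1 ∧ z 1 ∈ Set.Ioo (0:ℝ) 1} ⊆ Set.Icc 0 1 := by
    rintro z ⟨h0, h1⟩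
    refine ⟨fun i => ?_, fun i => ?_⟩ <;>
    · rcases Fin.eq_zero_or_eq_succ i with rfl | ⟨k, rfl⟩
      · simpa using by first | exact h0.1.le | exact h0.2.le
      · have hk : k = 0 := Fin.eq_zero k
        subst hk
        simpa using by first | exact h1.1.le | exact h1.2.le
  have hint : IntegrableOn (fun z : Fin 2 → ℝ => 16 / ((1 + z 0 ^ 2) * (1 + z 1 ^ 2)))
      {z : Fin 2 → ℝ | z 0 ∈ Set.Ioo (0:ℝ) 1 ∧ z 1 ∈ Set.Ioo (0:ℝ) 1} :=
    (hcont.continuousOn.integrableOn_compact isCompact_Icc).mono_set hsub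
  exact ⟨⟨_, _, KZ.isSemialgebraic_box2, hsa, hint⟩, rfl, fun _ _ => rfl⟩

/-- **`PiSquaredDegree` refutes `Flat`**: the square representation of `π²` exists and, by the
support item, is not `1`-dimensional, hence incompressible at dimension `2`.
[Kontsevich–Zagier 2001, §1.2] [folklore] -/
theorem not_flat_of_piSquaredDegree (hP : PiSquaredDegree) :
    ¬ ∀ (d : ℕ) (r : KZ.IntegralRep d), ∃ t : KZ.IntegralRep 1, KZ.Equivalent r t := by
  obtain ⟨q, hqd, hqi⟩ := exists_piSquaredRep
  exact not_flat_of_incompressible le_rfl q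
    (incompressible_of_not_equivalent_one
      (fun k hk t => t.exists_equivalent_of_le (show k ≤ 1 by omega)) q (hP q hqd hqi))

/-- **`PiSquaredDegree → SDC_{≥ 2} → KontsevichZagierPeriods`**: the top piece of the split is the
summit given the route's rank-9 support item (with `coresOfSummit_proof`: `SDC_{≥ 2} ↔ S` given it).
[Kontsevich–Zagier 2001, §1.2 Conjecture 1] [folklore] -/
theorem kontsevichZagierPeriods_of_piSquaredDegree_of_sameDegreeTwoUp (hP : PiSquaredDegree)
    (h2 : ∀ d : ℕ, 2 ≤ d → ∀ r r' : KZ.IntegralRep d,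
      (∀ k < d, ∀ t : KZ.IntegralRep k, ¬ KZ.Equivalent r t) →
      (∀ k < d, ∀ t : KZ.IntegralRep k, ¬ KZ.Equivalent r' t) → r.value = r'.value →
      KZ.Equivalent r r') :
    KontsevichZagierPeriods :=
  kontsevichZagierPeriods_of_sameDegreeTwoUp_of_not_flat h2 (not_flat_of_piSquaredDegree hP)

/-- Hence, given `PiSquaredDegree`, the bottom piece `SameDegreeOne` FOLLOWS from the top piece
`SDC_{≥ 2}` (through the summit and `coresOfSummit_proof` at `d = 1`).
[Kontsevich–Zagier 2001, §1.2 Conjecture 1] [folklore] -/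
theorem sameDegreeOne_of_piSquaredDegree_of_sameDegreeTwoUp (hP : PiSquaredDegree)
    (h2 : ∀ d : ℕ, 2 ≤ d → ∀ r r' : KZ.IntegralRep d,
      (∀ k < d, ∀ t : KZ.IntegralRep k, ¬ KZ.Equivalent r t) →
      (∀ k < d, ∀ t : KZ.IntegralRep k, ¬ KZ.Equivalent r' t) → r.value = r'.value →
      KZ.Equivalent r r') :
    SameDegreeOne := fun r r' hr hr' hv =>
  (coresOfSummit_proof (kontsevichZagierPeriods_of_piSquaredDegree_of_sameDegreeTwoUp hP h2)).2 1 r r'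
    (fun k hk t => by obtain rfl : k = 0 := Nat.lt_one_iff.mp hk; exact hr t)
    (fun k hk t => by obtain rfl : k = 0 := Nat.lt_one_iff.mp hk; exact hr' t) hv

/-! ## §5 The registered skeleton's cube stubs, read against `PiSquaredDegree` -/

/-- **Stubs 2 (open-cube normal form, `hN`) and 3 (cube rungs `d ≥ 2`, `hC`) of the registered
skeleton `Cruxes/SameDegreeConjecture/Lines/birth.lean` give the summit, given `PiSquaredDegree`**
(move both representations to the cube in the same dimension; incompressibility and the value travel
along) — so its stub 1 (`SameDegreeOne`) is implied by stubs 2–3 and the support item 6179. The stub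
statements are restated verbatim; the skeleton is not imported.
[Kontsevich–Zagier 2001, §1.2 Conjecture 1, Problem 2] [folklore] -/
theorem kontsevichZagierPeriods_of_piSquaredDegree_of_cubeStubs (hP : PiSquaredDegree)
    (hN : ∀ (d : ℕ) (r : KZ.IntegralRep d), ∃ c : KZ.IntegralRep d,
      c.domain = {z | ∀ i, z i ∈ Set.Ioo (0:ℝ) 1} ∧ KZ.Equivalent r c)
    (hC : ∀ (d : ℕ), 2 ≤ d → ∀ (c c' : KZ.IntegralRep d),
      c.domain = {z | ∀ i, z i ∈ Set.Ioo (0:ℝ) 1} → c'.domain = {z | ∀ i, z i ∈ Set.Ioo (0:ℝ) 1} →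
      (∀ k < d, ∀ s : KZ.IntegralRep k, ¬ KZ.Equivalent c s) →
      (∀ k < d, ∀ s : KZ.IntegralRep k, ¬ KZ.Equivalent c' s) → c.value = c'.value →
      KZ.Equivalent c c') :
    KontsevichZagierPeriods := by
  refine kontsevichZagierPeriods_of_piSquaredDegree_of_sameDegreeTwoUp hP fun d hd r r' hr hr' hv => ?_
  obtain ⟨c, hcd, hrc⟩ := hN d r
  obtain ⟨c', hc'd, hrc'⟩ := hN d r'
  have hcinc : ∀ k < d, ∀ s : KZ.IntegralRep k, ¬ KZ.Equivalent c s :=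
    fun k hk s hs => hr k hk s (hrc.trans hs)
  have hc'inc : ∀ k < d, ∀ s : KZ.IntegralRep k, ¬ KZ.Equivalent c' s :=
    fun k hk s hs => hr' k hk s (hrc'.trans hs)
  have hval : c.value = c'.value := by
    rw [← KZ.Equivalent.value_eq_holds hrc, ← KZ.Equivalent.value_eq_holds hrc', hv]
  exact (hrc.trans (hC d hd c c' hcd hc'd hcinc hc'inc hval)).trans hrc'.symm

end Summit.KontsevichZagierPeriods.HodgeColevel.SameDegreeTwoUpStrength

end
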